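import Summits.QuantumFields.BalabanUV.Beta.GAN24.PerturbedPropagatorVolumeLimit
import Summits.QuantumFields.BalabanUV.Beta.GAN24.EffectiveFormDecayBackground

/-!
# `BalabanUV.Beta.GAN24.PerturbedEffectiveFormVolumeLimit` — binder row G-an2-4 ∕ (CONV-C), routes R6 × R7 «TWO CURRENCIES», PART 152: `U ≠ 1` BEYOND FIRST ORDER — THE
# EFFECTIVE FORM WITH BACKGROUND `Σ_k(u) = c_k(u)⁻¹ − a″·1`, `c_k(u) = L^{dk}Q_k(Δ_a^{(k)} + u·P(V)^{(k)})⁻¹Q_kᴴ`, HAS THE β-CELL's WHOLE `LimitRate` END ON `ℤ^d` ON A COUPLING DISC,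
# MODULO ONLY THE BACKGROUND's POINTWISE LIMIT (PART 154: NOTHING displayed for constant ∕ eventually-pulled-back backgrounds).  PART 129 supplied (UD)+(SR) for `Σ_k(u)` volume-free on
# the disc (first-order model); PART 151 supplied EL₂ of `c_k(u)`; here: (a) the Neumann ratio `‖1 − Cst⁻¹·c_k(u)‖ ≤ 1 − γ_B∕(2Cst)` (PART 138's Hermitian ratio for `c_k` + NE2's
# Lipschitz-in-the-coupling bound `‖c_k(u) − c_k‖ ≤ ‖u‖κ₀Cst(1 − ‖u‖κ₀)⁻¹` — no accretivity needed), (b) the volume-uniform window decay of `c_k(u)` (PART 129's dictionary at an admissible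
# rate), (c) PART 151 ⟹ PART 144's `exists_tendsto_inv_pair` ⟹ EL₂ of `c_k(u)⁻¹`, hence of `Σ_k(u)`; PART 140's generic END closes (unit b2b-balaban-gan24-p3, gen 55; v1)

NOT IN PRINT; OUR PROOF ([folklore] bookkeeping BY NAME over PART 129 (`exists_decay_inv_pertCov_QB`, `twoLevelDecayRate_effForm_perturbed`, `hdecB_pert_of_wCoercive`), PART 151
(`tendsto_pertCov_pair`), PART 144 (`exists_tendsto_inv_pair`), PART 140 (`conv_of_decay_of_tendsto`), PART 143 (`tendsto_one_pair`), PART 142 (`norm_le_exp_window_of_entryDecay`),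
PART 138 (`opNorm_one_sub_smul_unitCovB_le`, `one_sub_smul_reindex`), PART 130 ∕ 128 ∕ 127 (rate monotonicity, `entryDecay_one ∕ _smul ∕ _sub`), PART 124 (`hPc_firstOrder`,
`exists_admissible_rate`), NE2's `BackgroundResolventTower.opNorm_avgTow_perturbed_sub_le`, `FirstOrderBackgroundModel`, `KingPairingPlantedLaw`, `CTConjDefectDischarge.conjDefect_calDalev_rho`,
`CTConjugatedHbd`, `CTAdmissibleRate.exists_pos_le_one_of_eventually`; [Balaban1987RG1] (1.21)–(1.22) p. 264 LOCATE the shapes; nothing printed is a hypothesis).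
HONEST FRAMING (cell contract, verbatim): «discharging `BetaPertH` makes Bałaban's UV stability UNCONDITIONAL — a real constructive-QFT result; it is NOT the
continuum limit and NOT the Clay problem.»  HONEST DEPENDENCY (verbatim): «continuum YM on T⁴ ⇐ BetaPertH ∧ nine spine estimates (0/9 proved); BetaPertH ⇐
(D1) ∧ (D4) ∧ CAP+tail; G-an2-4 gates asym, D1 and NE2/3/4.»

WHAT THIS FILE PROVES (0 sorry, 0 `def`; `κ₀ = d(α+β)Cst`, `κ_c = d·α·G2(…)`, `γ_B = gammaB d a`; the COUPLING DISC is PART 129's: `T ≥ 0`, `Tκ₀ ≤ 1∕2`, `Tκ_c ≤ 1∕2`, `4Tκ₀Cst ≤ γ_B` at an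
admissible fine rate `κ` (`Jfree < γ_Ps`, `δ_K < σ₀²`, `J_A < γ_D` at `a′ > 0`); `e = unitIdx⁻¹`, `ẑ_t` the reading of `z ∈ ℤ^d`):
* §1 `avgTow_inv_calDalev_eq`, **`opNorm_one_sub_smul_pertCov_le`** ((a): `‖1 − Cst⁻¹•c_k(u)‖ ≤ 1 − γ_B∕(2Cst)` for every torus, Lipschitz background, `‖u‖ ≤ T`, level; `d ≥ 1`),
  `one_sub_half_ratio_lt_one`.
* §2 **`exists_windowDecay_pertCov`** ((b): `∃ B_c ≥ 0` from the disc data with `‖c_k(u)(e(w,λ),e(y,ν))‖ ≤ B_c·e^{−(κ∕d)|windowMap(w − y)|₁}` on EVERY cubic torus, background, coupling, level).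
* §3 **`tendsto_inv_pertCov_pair`** (EL₂ of `c_k(u)⁻¹` at unit integer pairs, `d ≥ 3`, even cubic volumes, modulo EL₁ of `V_t` at level `k`), **`tendsto_effFormPert_pair`** (EL₂ of `Σ_k(u)`).
* §4 **`conv_effFormPert_of_tendsto_background`** — THE END (`d ≥ 3`, `L ≥ 2`, `a > 0`, `μ ≠ ν`, even cubic volumes, the disc, `‖u‖ ≤ T`, any `a″`): for every volume-indexed family of
  Lipschitz backgrounds (`α, β` uniform) DISPLAYING ONLY EL₁ of `V_t`: `∃ δ₀ > 0, B, B′ ≥ 0, Π` with `IsInfiniteVolumeLimit evenPeriod (Re Σ_k(u)(e(·,μ′),e(0,ν′))) (Π k)`,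
  `UniformDecay Π μ ν B (δ₀∕d)`, `StepRate Π μ ν B′ (δ₀∕d) (√(L⁻¹))`, `KernelInputs d Π`, `|secondMoment (Π k) μ ν − secondMoment Π_∞ μ ν| ≤ β′_d(B′∕(1−√(L⁻¹)), δ₀∕d)·(√(L⁻¹))^k`.
(PART 154 `PerturbedEffectiveFormVolumeLimitInstances`: the eventually-pulled-back and constant classes with NOTHING displayed, and the `∃ T > 0` packaged END.)
WHAT IT DOES NOT DO: large couplings ∕ the full `U`-dependence beyond the first-order model `Δ_a + uP(V)`; Bałaban's shaped `P_B`; `d ≤ 2` ∕ odd volumes; identify `Π_∞`.  SUPPLIER work;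
NEVER «G-an2-4 closed»; NOT (CONV-C), NOT D1, NOT `BetaPertH`, NOT continuum, NOT Clay.  Records: `HOME/b2b-balaban-gan24-p3/gen55/README.md`.
-/

noncomputable section

open scoped BigOperators ComplexConjugate Matrix Matrix.Norms.L2Operator
open Filter Topology

namespace Summit.QuantumFields.BalabanUV.Beta.GAN24.PerturbedEffectiveFormVolumeLimit

open Literature.MathematicalPhysics.QuantumFieldTheory.Balaban1983to89
open Literature.MathematicalPhysics.QuantumFieldTheory.Balaban1983to89.B5Prop11Plancherel (Tor fine Cst Cst_nonneg opNorm_reindex)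
open Literature.MathematicalPhysics.QuantumFieldTheory.Balaban1983to89.B5G183RateUnitTower (lev)
open Literature.MathematicalPhysics.QuantumFieldTheory.Balaban1983to89.B12Sec2to5 (l1 betaPrime510)
open Literature.MathematicalPhysics.QuantumFieldTheory.Balaban1983to89.Beta (Site windowMap IsInfiniteVolumeLimit)
open Literature.MathematicalPhysics.QuantumFieldTheory.Balaban1983to89.Beta.FreeLegDictionary (cubic)
open Literature.MathematicalPhysics.QuantumFieldTheory.Balaban1983to89.Beta.BlockKernelVolumeSockets (evenPeriod tendsto_evenPeriod)
open Literature.MathematicalPhysics.QuantumFieldTheory.Balaban1983to89.Beta.VectorTails (castT)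
open Literature.MathematicalPhysics.QuantumFieldTheory.Balaban1983to89.Beta.LimitRate (StepRate limKernelOf KernelInputs)
open Summit.QuantumFields.BalabanUV.T4Continuum
open Summit.QuantumFields.BalabanUV.T4Continuum.CoerciveInverseTower (Coercive)
open Summit.QuantumFields.BalabanUV.T4Continuum.CovariantAveragingTower (avgTow)
open Summit.QuantumFields.BalabanUV.T4Continuum.BalabanAveragedTowerUnit (idx QBlev calGlev unitCovB one_le_lev' opNorm_QBlev_sq_le)
open Summit.QuantumFields.BalabanUV.T4Continuum.BalabanAveragedCoercive (gammaB gammaB_pos)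
open Summit.QuantumFields.BalabanUV.T4Continuum.BalabanAveragedCoerciveTower (unitIdx)
open Summit.QuantumFields.BalabanUV.T4Continuum.BackgroundResolventTower (opNorm_avgTow_perturbed_sub_le)
open Summit.QuantumFields.BalabanUV.T4Continuum.KingPairingPlantedLaw (calDalev calDalev_inv isUnit_det_calDalev opNorm_inv_calDalev_le)
open Summit.QuantumFields.BalabanUV.T4Continuum.FirstOrderBackgroundModel (LipschitzBackground Pmodel perturbationLaws_firstOrder)
open Summit.QuantumFields.BalabanUV.T4Continuum.CTWeightedCoercivity (conjMat WCoercive)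
open Summit.QuantumFields.BalabanUV.T4Continuum.CTKingTowerWeights (rho distK)
open Summit.QuantumFields.BalabanUV.T4Continuum.CTConjugatedHbd (G2 G2_nonneg wCoercive_calDa_of_conjDefect)
open Summit.QuantumFields.BalabanUV.T4Continuum.CTConjDefectDischarge (conjDefect_calDalev_rho max_JA_lt_gamD)
open Summit.QuantumFields.BalabanUV.T4Continuum.DirichletRegionTower (gamD gamD_pos)
open Summit.QuantumFields.BalabanUV.T4Continuum.ScalarAveragedPropagator (gammaPs)
open Summit.QuantumFields.BalabanUV.T4Continuum.ScalarAveragedCompression (sigma0)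
open Summit.QuantumFields.BalabanUV.T4Continuum.CTScalarGreen (Jfree)
open Summit.QuantumFields.BalabanUV.T4Continuum.CTGaugeTerm (deltaK)
open Summit.QuantumFields.BalabanUV.T4Continuum.CTVectorPropagator (JA)
open Summit.QuantumFields.BalabanUV.T4Continuum.DecayRateInterpolation (EntryDecay TwoLevelDecayRate entryDecay_sub)
open Summit.QuantumFields.BalabanUV.Beta.GAN24.InsertionChainDecay (hPc_firstOrder)
open Summit.QuantumFields.BalabanUV.Beta.GAN24.EffectiveFormDecayBackground (hdecB_pert_of_wCoercive exists_decay_inv_pertCov_QB twoLevelDecayRate_effForm_perturbed)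
open Summit.QuantumFields.BalabanUV.Beta.GAN24.UnitLatticeDecayAlgebra (distK_nonneg distK_self entryDecay_smul entryDecay_one)
open Summit.QuantumFields.BalabanUV.Beta.GAN24.EffectiveFormDecay (entryDecay_of_le_rate)
open Summit.QuantumFields.BalabanUV.Beta.GAN24.DiagramDecayAlgebra (twoLevelDecayRate_of_le_rate)
open Summit.QuantumFields.BalabanUV.Beta.GAN24.VolumeLimitCovariance (one_sub_smul_reindex opNorm_one_sub_smul_unitCovB_le)
open Summit.QuantumFields.BalabanUV.Beta.GAN24.DiagramVolumeLimitPairs (norm_le_exp_window_of_entryDecay)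
open Summit.QuantumFields.BalabanUV.Beta.GAN24.DiagramVolumeLimitSandwich (tendsto_one_pair)
open Summit.QuantumFields.BalabanUV.Beta.GAN24.VolumeLimitPairsFibre (exists_tendsto_inv_pair)
open Summit.QuantumFields.BalabanUV.Beta.GAN24.DiagramVolumeLimit (conv_of_decay_of_tendsto)
open Summit.QuantumFields.BalabanUV.Beta.GAN24.PerturbedPropagatorVolumeLimit (tendsto_pertCov_pair)

variable {d : ℕ} (L : ℕ) [NeZero L]

/-! ## §1 (a) The Neumann ratio of the perturbed block covariance on the coupling disc -/

section OneTorus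

variable (M : Fin d → ℕ) [hM : ∀ μ, NeZero (M μ)] (a : ℝ) (ha : 0 < a)

/-- `L^{dk}Q_k(Δ_a^{(k)})⁻¹Q_kᴴ = c_k` (the unperturbed member of the family IS `unitCovB`). [folklore] -/
theorem avgTow_inv_calDalev_eq (k : ℕ) : avgTow (QBlev L M) ((L : ℝ) ^ d) (fun k => (calDalev L M a ha k)⁻¹) k = unitCovB L M a ha k := by
  unfold unitCovB; congr 1; funext j; rw [calDalev_inv]

/-- **`opNorm_one_sub_smul_pertCov_le` — (a) THE NEUMANN RATIO ON THE DISC** [our proof] (`d ≥ 1`; any torus; `κ₀ = d(α+β)Cst`): for a Lipschitz background `(α, β)`, `‖u‖ ≤ T` with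
`Tκ₀ ≤ 1∕2` and `4Tκ₀Cst ≤ γ_B`: `‖1 − Cst⁻¹•c_k(u)‖ ≤ 1 − γ_B∕(2Cst)` (read on `Tor M × Fin d`) — PART 138's Hermitian ratio `1 − γ_B∕Cst` for `c_k` plus `Cst⁻¹‖c_k(u) − c_k‖ ≤
‖u‖κ₀(1 − ‖u‖κ₀)⁻¹ ≤ 2Tκ₀ ≤ γ_B∕(2Cst)` (NE2's `opNorm_avgTow_perturbed_sub_le`). -/
theorem opNorm_one_sub_smul_pertCov_le (hd : 1 ≤ d) {V : (k : ℕ) → Fin d → (idx L M k → ℂ)} {α β : ℝ} (hV : LipschitzBackground L M V α β) {T : ℝ}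
    (hT₁ : T * (d * (α + β) * Cst d a) ≤ 1 / 2) (hT₃ : 4 * T * (d * (α + β) * Cst d a) * Cst d a ≤ gammaB d a) {u : ℂ} (hu : ‖u‖ ≤ T) (k : ℕ) :
    ‖(1 : Matrix (Tor M × Fin d) (Tor M × Fin d) ℂ) - (((Cst d a)⁻¹ : ℝ) : ℂ) •
        Matrix.reindex (unitIdx L M) (unitIdx L M) (avgTow (QBlev L M) ((L : ℝ) ^ d) (fun k => (calDalev L M a ha k + u • Pmodel L M V k)⁻¹) k)‖
      ≤ 1 - gammaB d a / (2 * Cst d a) := by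
  rw [one_sub_smul_reindex, opNorm_reindex]
  set κ₀ : ℝ := d * (α + β) * Cst d a with hκ₀
  set cu := avgTow (QBlev L M) ((L : ℝ) ^ d) (fun k => (calDalev L M a ha k + u • Pmodel L M V k)⁻¹) k with hcu
  have hC : 0 < Cst d a := lt_of_lt_of_le zero_lt_one (le_max_of_le_right (le_max_right _ _))
  have hκ₀0 : 0 ≤ κ₀ := by have := hV.nonneg.1; have := hV.nonneg.2; have := hC.le; positivity
  have hT0 : 0 ≤ T := (norm_nonneg u).trans hu
  have huκ : ‖u‖ * κ₀ ≤ T * κ₀ := mul_le_mul_of_nonneg_right hu hκ₀0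
  have huκ1 : ‖u‖ * κ₀ < 1 := by linarith
  -- PART 138's Hermitian ratio for `c_k`, read back on `idx`
  have h138 := opNorm_one_sub_smul_unitCovB_le L M a ha hd k
  rw [one_sub_smul_reindex, opNorm_reindex] at h138
  -- NE2's Lipschitz bound in the coupling
  have hr : (0 : ℝ) < (L : ℝ) ^ d := pow_pos (by exact_mod_cast Nat.pos_of_ne_zero (NeZero.ne L)) d
  have hγ : ∀ k, ‖(calDalev L M a ha k)⁻¹‖ ≤ ((Cst d a)⁻¹)⁻¹ := fun k => by rw [inv_inv]; exact opNorm_inv_calDalev_le L M a ha k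
  have hpert := perturbationLaws_firstOrder L M a ha hd hV
  have hE := opNorm_avgTow_perturbed_sub_le hr (opNorm_QBlev_sq_le L M) (isUnit_det_calDalev L M a ha) hγ hpert.opNorm_P_mul_inv_le
    hpert.opNorm_inv_mul_P_le huκ1 k
  rw [inv_inv, avgTow_inv_calDalev_eq, ← hcu] at hE
  have hν : (1 - ‖u‖ * κ₀)⁻¹ ≤ 2 := by
    have h1 : (1 : ℝ) / 2 ≤ 1 - ‖u‖ * κ₀ := by linarith
    have := inv_anti₀ (by norm_num : (0 : ℝ) < 1 / 2) h1
    rwa [one_div, inv_inv] at this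
  have hν0 : 0 ≤ (1 - ‖u‖ * κ₀)⁻¹ := inv_nonneg.mpr (by linarith)
  have hτ : ‖(((Cst d a)⁻¹ : ℝ) : ℂ)‖ = (Cst d a)⁻¹ := by rw [Complex.norm_real, Real.norm_of_nonneg (inv_nonneg.mpr hC.le)]
  have e1 : (1 : Matrix (idx L M 0) (idx L M 0) ℂ) - (((Cst d a)⁻¹ : ℝ) : ℂ) • cu
      = ((1 : Matrix (idx L M 0) (idx L M 0) ℂ) - (((Cst d a)⁻¹ : ℝ) : ℂ) • unitCovB L M a ha k) - (((Cst d a)⁻¹ : ℝ) : ℂ) • (cu - unitCovB L M a ha k) := by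
    rw [smul_sub]; abel
  rw [e1]
  have h2 : ‖(((Cst d a)⁻¹ : ℝ) : ℂ) • (cu - unitCovB L M a ha k)‖ ≤ ‖u‖ * κ₀ * (1 - ‖u‖ * κ₀)⁻¹ := by
    rw [norm_smul, hτ]
    calc (Cst d a)⁻¹ * ‖cu - unitCovB L M a ha k‖ ≤ (Cst d a)⁻¹ * (‖u‖ * κ₀ * Cst d a * (1 - ‖u‖ * κ₀)⁻¹) :=
          mul_le_mul_of_nonneg_left hE (inv_nonneg.mpr hC.le)
      _ = ‖u‖ * κ₀ * (1 - ‖u‖ * κ₀)⁻¹ := by field_simp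
  have h3 : ‖u‖ * κ₀ * (1 - ‖u‖ * κ₀)⁻¹ ≤ T * κ₀ * 2 := mul_le_mul huκ hν hν0 (by positivity)
  have h4 : T * κ₀ * 2 ≤ gammaB d a / (2 * Cst d a) := by
    rw [le_div_iff₀ (by positivity)]
    have : 4 * T * κ₀ * Cst d a ≤ gammaB d a := by rw [hκ₀]; linarith [hT₃]
    linarith
  calc ‖((1 : Matrix (idx L M 0) (idx L M 0) ℂ) - (((Cst d a)⁻¹ : ℝ) : ℂ) • unitCovB L M a ha k) - (((Cst d a)⁻¹ : ℝ) : ℂ) • (cu - unitCovB L M a ha k)‖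
      ≤ ‖(1 : Matrix (idx L M 0) (idx L M 0) ℂ) - (((Cst d a)⁻¹ : ℝ) : ℂ) • unitCovB L M a ha k‖ + ‖(((Cst d a)⁻¹ : ℝ) : ℂ) • (cu - unitCovB L M a ha k)‖ := norm_sub_le _ _
    _ ≤ (1 - gammaB d a / Cst d a) + gammaB d a / (2 * Cst d a) := add_le_add h138 (h2.trans (h3.trans h4))
    _ = 1 - gammaB d a / (2 * Cst d a) := by ring

include ha in
/-- the perturbed ratio is `< 1`. [folklore] -/
theorem one_sub_half_ratio_lt_one : 1 - gammaB d a / (2 * Cst d a) < 1 := by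
  have hC : 0 < Cst d a := lt_of_lt_of_le zero_lt_one (le_max_of_le_right (le_max_right _ _))
  have := div_pos (gammaB_pos (d := d) a ha) (mul_pos two_pos hC)
  linarith

end OneTorus

/-! ## §2 (b) The volume-uniform window decay of `c_k(u)` on cubic tori (PART 129's dictionary on the disc) -/

variable (a : ℝ) (ha : 0 < a)

/-- **`exists_windowDecay_pertCov` — (b) VOLUME-UNIFORM WINDOW DECAY OF `c_k(u)`** [our proof]: on PART 129's coupling disc (admissible fine rate `κ` at `a′`, `Tκ_c ≤ 1∕2`) there is
`B_c ≥ 0` (from `(d, a, a′, κ)`) with `‖c_k(u)(e(w,λ), e(y,ν))‖ ≤ B_c·e^{−(κ∕d)|windowMap(w − y)|₁}` for EVERY cubic torus, Lipschitz background `(α, β)`, `‖u‖ ≤ T`, level and pair —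
PART 129's `hdecB_pert_of_wCoercive` (with NE2's `conjDefect_calDalev_rho` and PART 124's `hPc_firstOrder`) read through PART 142's window inequality. -/
theorem exists_windowDecay_pertCov {α β a' κ T : ℝ} (hα : 0 ≤ α) (ha' : 0 < a') (hκ0 : 0 < κ)
    (hγ' : Jfree d a' κ 1 < gammaPs d a') (hδ' : deltaK d a' κ 1 < sigma0 d a' ^ 2) (hJA : JA d a a' κ 1 < gamD d a)
    (hT₂ : T * (d * (α * G2 d a (max (JA d a a' κ 1) 0) (gamD d a - max (JA d a a' κ 1) 0) κ)) ≤ 1 / 2) :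
    ∃ Bc : ℝ, 0 ≤ Bc ∧ ∀ (s : ℕ) [NeZero s] (V : (k : ℕ) → Fin d → (idx L (cubic d s) k → ℂ)), LipschitzBackground L (cubic d s) V α β →
      ∀ (u : ℂ), ‖u‖ ≤ T → ∀ (k : ℕ) (w : Site d s) (l : Fin d) (y : Site d s) (ν : Fin d),
        ‖Matrix.reindex (unitIdx L (cubic d s)) (unitIdx L (cubic d s))
            (avgTow (QBlev L (cubic d s)) ((L : ℝ) ^ d) (fun k => (calDalev L (cubic d s) a ha k + u • Pmodel L (cubic d s) V k)⁻¹) k) (w, l) (y, ν)‖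
          ≤ Bc * Real.exp (-(κ / d) * l1 (windowMap d s (w - y))) := by
  set J : ℝ := max (JA d a a' κ 1) 0 with hJdef
  have hJ0 : 0 ≤ J := le_max_right _ _
  have hJγ : J < gamD d a := max_JA_lt_gamD a hJA
  set κc : ℝ := d * (α * G2 d a J (gamD d a - J) κ) with hκc
  have hκc0 : 0 ≤ κc := by have := G2_nonneg (d := d) a J (sub_pos.mpr hJγ) κ; positivity
  refine ⟨(gamD d a - J)⁻¹ * 2 * Real.exp (κ * 4), by have := sub_pos.mpr hJγ; positivity, fun s _ V hV u hu k w l y ν => ?_⟩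
  have hW : ∀ (k : ℕ) (y : idx L (cubic d s) 0), WCoercive (calDalev L (cubic d s) a ha k) κ (rho L (cubic d s) k y) (gamD d a - J) :=
    fun k y => wCoercive_calDa_of_conjDefect (lev L k) (one_le_lev' L k) (cubic d s) a ha (conjDefect_calDalev_rho L (cubic d s) a ha ha' hγ' hδ' k y)
  have hPc : ∀ (k : ℕ) (y : idx L (cubic d s) 0),
      ‖conjMat κ (rho L (cubic d s) k y) (rho L (cubic d s) k y) (Pmodel L (cubic d s) V k)
        * conjMat κ (rho L (cubic d s) k y) (rho L (cubic d s) k y) (calDalev L (cubic d s) a ha k)⁻¹‖ ≤ κc :=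
    fun k y => hPc_firstOrder L (cubic d s) a ha hV hJ0 hJγ k y (conjDefect_calDalev_rho L (cubic d s) a ha ha' hγ' hδ' k y)
  have htc : ‖u‖ * κc < 1 := by nlinarith [mul_le_mul_of_nonneg_right hu hκc0, norm_nonneg u]
  have hdec0 := hdecB_pert_of_wCoercive L (cubic d s) a ha (P := Pmodel L (cubic d s) V) hκ0.le (sub_pos.mpr hJγ) hW hPc htc k
  have hνc : (1 - ‖u‖ * κc)⁻¹ ≤ 2 := by
    have h1 : (1 : ℝ) / 2 ≤ 1 - ‖u‖ * κc := by nlinarith [mul_le_mul_of_nonneg_right hu hκc0, norm_nonneg u]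
    have := inv_anti₀ (by norm_num : (0 : ℝ) < 1 / 2) h1
    rwa [one_div, inv_inv] at this
  have hdec : EntryDecay (distK L (cubic d s)) (avgTow (QBlev L (cubic d s)) ((L : ℝ) ^ d) (fun k => (calDalev L (cubic d s) a ha k + u • Pmodel L (cubic d s) V k)⁻¹) k)
      ((gamD d a - J)⁻¹ * 2 * Real.exp (κ * 4)) κ := by
    refine hdec0.mono ?_
    have h1 : 0 ≤ (gamD d a - J)⁻¹ := inv_nonneg.mpr (sub_pos.mpr hJγ).le
    gcongr
  have h := norm_le_exp_window_of_entryDecay L s hκ0.le hdec w l y ν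
  simpa only [Matrix.reindex_apply, Matrix.submatrix_apply] using h

/-! ## §3 (c) ⟹ EL₂ of `c_k(u)⁻¹` and of `Σ_k(u)` on the unit lattice -/

/-- **`tendsto_inv_pertCov_pair` — EL₂ OF THE INVERSE PERTURBED BLOCK COVARIANCE** [our proof] (`d ≥ 3`, `a > 0`, level `k`, even cubic volumes, PART 129's disc, `‖u‖ ≤ T`): for a
volume-indexed family of Lipschitz backgrounds (`α, β` uniform) with EL₁ at level `k`, `∀ μ ν z z′, ∃ s, c_k(u)⁻¹(e(ẑ_t,μ), e(ẑ′_t,ν)) → s` — PART 144's `exists_tendsto_inv_pair` on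
`A_t = c_k(u)` read on `Site × Fin d` ((a) §1, (b) §2, (c) PART 151). [cite: Balaban1987RG1, p.264 (after (1.21): the `T ↗ ℤ^d` limit)] -/
theorem tendsto_inv_pertCov_pair (hd : 3 ≤ d) {α β a' κ T : ℝ} (ha' : 0 < a') (hκ0 : 0 < κ)
    (hγ' : Jfree d a' κ 1 < gammaPs d a') (hδ' : deltaK d a' κ 1 < sigma0 d a' ^ 2) (hJA : JA d a a' κ 1 < gamD d a)
    (hT₁ : T * (d * (α + β) * Cst d a) ≤ 1 / 2)
    (hT₂ : T * (d * (α * G2 d a (max (JA d a a' κ 1) 0) (gamD d a - max (JA d a a' κ 1) 0) κ)) ≤ 1 / 2)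
    (hT₃ : 4 * T * (d * (α + β) * Cst d a) * Cst d a ≤ gammaB d a) (k : ℕ)
    {V : (t : ℕ) → (k : ℕ) → Fin d → (idx L (cubic d (evenPeriod t)) k → ℂ)} (hV : ∀ t, LipschitzBackground L (cubic d (evenPeriod t)) (V t) α β)
    (hV1 : ∀ (μ f : Fin d) (z : Fin d → ℤ), ∃ s : ℂ, Tendsto (fun t => V t k μ (castT (cubic d (lev L k * evenPeriod t)) z, f)) atTop (𝓝 s))
    {u : ℂ} (hu : ‖u‖ ≤ T) (μ ν : Fin d) (z z' : Fin d → ℤ) :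
    ∃ s : ℂ, Tendsto (fun t => (avgTow (QBlev L (cubic d (evenPeriod t))) ((L : ℝ) ^ d)
        (fun k' => (calDalev L (cubic d (evenPeriod t)) a ha k' + u • Pmodel L (cubic d (evenPeriod t)) (V t) k')⁻¹) k)⁻¹
      ((unitIdx L (cubic d (evenPeriod t))).symm (castT (cubic d (evenPeriod t)) z, μ)) ((unitIdx L (cubic d (evenPeriod t))).symm (castT (cubic d (evenPeriod t)) z', ν)))
      atTop (𝓝 s) := by
  have hd1 : 1 ≤ d := le_trans (by norm_num) hd
  have hd0 : (0 : ℝ) < d := by exact_mod_cast lt_of_lt_of_le zero_lt_one hd1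
  have hα : 0 ≤ α := (hV 0).nonneg.1
  have hκ₀0 : 0 ≤ d * (α + β) * Cst d a := by have := (hV 0).nonneg.2; have := Cst_nonneg d a; positivity
  have hTκ : T * (d * (α + β) * Cst d a) < 1 := by linarith
  obtain ⟨Bc, hBc0, hdec⟩ := exists_windowDecay_pertCov L a ha (β := β) hα ha' hκ0 hγ' hδ' hJA hT₂
  have hδ : 0 < κ / d := div_pos hκ0 hd0
  obtain ⟨s, hs⟩ := exists_tendsto_inv_pair (d := d) (F := Fin d) (side := evenPeriod) tendsto_evenPeriod
    (A := fun t => Matrix.reindex (unitIdx L (cubic d (evenPeriod t))) (unitIdx L (cubic d (evenPeriod t)))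
      (avgTow (QBlev L (cubic d (evenPeriod t))) ((L : ℝ) ^ d)
        (fun k' => (calDalev L (cubic d (evenPeriod t)) a ha k' + u • Pmodel L (cubic d (evenPeriod t)) (V t) k')⁻¹) k))
    (τ := (((Cst d a)⁻¹ : ℝ) : ℂ)) (fun t => opNorm_one_sub_smul_pertCov_le L (cubic d (evenPeriod t)) a ha hd1 (hV t) hT₁ hT₃ hu k)
    (one_sub_half_ratio_lt_one a ha) (fun t w g y h => hdec (evenPeriod t) (V t) (hV t) u hu k w g y h) hδ
    (fun f g w w' => tendsto_pertCov_pair L a ha hd hTκ k hV hV1 hu f g w w') μ ν z z'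
  refine ⟨s, hs.congr fun t => ?_⟩
  rw [Matrix.inv_reindex]
  simp only [Matrix.reindex_apply, Matrix.submatrix_apply]

/-- **`tendsto_effFormPert_pair` — EL₂ OF THE EFFECTIVE FORM WITH BACKGROUND `Σ_k(u) = c_k(u)⁻¹ − a″·1`** [our proof] (hypotheses of `tendsto_inv_pertCov_pair`, any `a″`).
[cite: Balaban1987RG1, p.264 (after (1.21): the `T ↗ ℤ^d` limit)] -/
theorem tendsto_effFormPert_pair (hd : 3 ≤ d) {α β a' κ T : ℝ} (ha' : 0 < a') (hκ0 : 0 < κ)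
    (hγ' : Jfree d a' κ 1 < gammaPs d a') (hδ' : deltaK d a' κ 1 < sigma0 d a' ^ 2) (hJA : JA d a a' κ 1 < gamD d a)
    (hT₁ : T * (d * (α + β) * Cst d a) ≤ 1 / 2)
    (hT₂ : T * (d * (α * G2 d a (max (JA d a a' κ 1) 0) (gamD d a - max (JA d a a' κ 1) 0) κ)) ≤ 1 / 2)
    (hT₃ : 4 * T * (d * (α + β) * Cst d a) * Cst d a ≤ gammaB d a) (k : ℕ)
    {V : (t : ℕ) → (k : ℕ) → Fin d → (idx L (cubic d (evenPeriod t)) k → ℂ)} (hV : ∀ t, LipschitzBackground L (cubic d (evenPeriod t)) (V t) α β)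
    (hV1 : ∀ (μ f : Fin d) (z : Fin d → ℤ), ∃ s : ℂ, Tendsto (fun t => V t k μ (castT (cubic d (lev L k * evenPeriod t)) z, f)) atTop (𝓝 s))
    {u : ℂ} (hu : ‖u‖ ≤ T) (a'' : ℂ) (μ ν : Fin d) (z z' : Fin d → ℤ) :
    ∃ s : ℂ, Tendsto (fun t => ((avgTow (QBlev L (cubic d (evenPeriod t))) ((L : ℝ) ^ d)
        (fun k' => (calDalev L (cubic d (evenPeriod t)) a ha k' + u • Pmodel L (cubic d (evenPeriod t)) (V t) k')⁻¹) k)⁻¹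
        - a'' • (1 : Matrix (idx L (cubic d (evenPeriod t)) 0) (idx L (cubic d (evenPeriod t)) 0) ℂ))
      ((unitIdx L (cubic d (evenPeriod t))).symm (castT (cubic d (evenPeriod t)) z, μ)) ((unitIdx L (cubic d (evenPeriod t))).symm (castT (cubic d (evenPeriod t)) z', ν)))
      atTop (𝓝 s) := by
  obtain ⟨s₁, hs₁⟩ := tendsto_inv_pertCov_pair L a ha hd ha' hκ0 hγ' hδ' hJA hT₁ hT₂ hT₃ k hV hV1 hu μ ν z z'
  obtain ⟨s₂, hs₂⟩ := tendsto_one_pair L (d := d) tendsto_evenPeriod μ ν z z'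
  refine ⟨s₁ - a'' * s₂, ?_⟩
  simp only [Matrix.sub_apply, Matrix.smul_apply, smul_eq_mul]
  exact hs₁.sub (hs₂.const_mul a'')

/-! ## §4 THE END for the effective form with background, modulo the background's pointwise limit -/

/-- `castT 0 = 0`. [folklore] -/
theorem castT_zero (N : Fin d → ℕ) : castT N (0 : Fin d → ℤ) = 0 := by
  funext i; simp [castT]

/-- **`conv_effFormPert_of_tendsto_background` — THE EFFECTIVE FORM WITH BACKGROUND ON `ℤ^d`, MODULO ONLY THE BACKGROUND's POINTWISE LIMIT** [our proof] (`d ≥ 3`, `L ≥ 2`,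
`a > 0`, `μ ≠ ν`, even cubic volumes `2(t+1)`; PART 129's coupling disc at an admissible rate; `‖u‖ ≤ T`; any regulator `a″`): for a volume-indexed family of backgrounds with
`LipschitzBackground L (cubic d (2(t+1))) (V t) α β` (constants uniform in the volume) whose readings converge at every fixed fine integer point (`∀ k μ f z, ∃ s, V_t k μ (ẑ_t,f) → s` —
DISPLAYED), the tower `Σ_k(u) = c_k(u)⁻¹ − a″·1`, `c_k(u) = L^{dk}Q_k(Δ_a^{(k)} + u·P(V_t)^{(k)})⁻¹Q_kᴴ`, has: `δ₀ > 0`, `B, B′ ≥ 0`, limit kernels `Π_k` with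
`IsInfiniteVolumeLimit evenPeriod (Re Σ_k(u)(e(·,μ′),e(0,ν′))) (Π k)`, `UniformDecay Π μ ν B (δ₀∕d)`, `StepRate Π μ ν B′ (δ₀∕d) (√(L⁻¹))`, `KernelInputs d Π` (`θ = √(L⁻¹)`,
`c₀ = β′_d(B′∕(1−√(L⁻¹)), δ₀∕d)`), and `∀ k, |secondMoment (Π k) μ ν − secondMoment (limKernelOf Π) μ ν| ≤ β′_d(B′∕(1−√(L⁻¹)), δ₀∕d)·(√(L⁻¹))^k` — PART 140's generic END on PART 129's
(UD)+(SR) (rates matched by monotonicity) and §3's EL₂.  The `U ≠ 1` twin of PART 139, all orders in `u` on the disc. [cite: Balaban1987RG1, (1.21)–(1.22) p.264 (shapes)] -/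
theorem conv_effFormPert_of_tendsto_background (hL : 2 ≤ L) (hd : 3 ≤ d) {μ ν : Fin d} (hne : μ ≠ ν) {α β a' κ T : ℝ} (ha' : 0 < a') (hκ0 : 0 < κ)
    (hγ' : Jfree d a' κ 1 < gammaPs d a') (hδ' : deltaK d a' κ 1 < sigma0 d a' ^ 2) (hJA : JA d a a' κ 1 < gamD d a) (hT0 : 0 ≤ T)
    (hT₁ : T * (d * (α + β) * Cst d a) ≤ 1 / 2)
    (hT₂ : T * (d * (α * G2 d a (max (JA d a a' κ 1) 0) (gamD d a - max (JA d a a' κ 1) 0) κ)) ≤ 1 / 2)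
    (hT₃ : 4 * T * (d * (α + β) * Cst d a) * Cst d a ≤ gammaB d a)
    {V : (t : ℕ) → (k : ℕ) → Fin d → (idx L (cubic d (evenPeriod t)) k → ℂ)} (hV : ∀ t, LipschitzBackground L (cubic d (evenPeriod t)) (V t) α β)
    (hV1 : ∀ k (μ f : Fin d) (z : Fin d → ℤ), ∃ s : ℂ, Tendsto (fun t => V t k μ (castT (cubic d (lev L k * evenPeriod t)) z, f)) atTop (𝓝 s))
    {u : ℂ} (hu : ‖u‖ ≤ T) (a'' : ℂ) :
    ∃ δ₀ B B' : ℝ, 0 < δ₀ ∧ 0 ≤ B ∧ 0 ≤ B' ∧ ∃ Pinf : ℕ → B12Beta.Kernel d,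
      (∀ k, IsInfiniteVolumeLimit evenPeriod
        (fun t μ' ν' (z : Site d (evenPeriod t)) => (((avgTow (QBlev L (cubic d (evenPeriod t))) ((L : ℝ) ^ d)
            (fun k' => (calDalev L (cubic d (evenPeriod t)) a ha k' + u • Pmodel L (cubic d (evenPeriod t)) (V t) k')⁻¹) k)⁻¹
            - a'' • (1 : Matrix (idx L (cubic d (evenPeriod t)) 0) (idx L (cubic d (evenPeriod t)) 0) ℂ))
          ((unitIdx L (cubic d (evenPeriod t))).symm (z, μ')) ((unitIdx L (cubic d (evenPeriod t))).symm (0, ν'))).re) (Pinf k)) ∧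
      Beta.LimitRate.UniformDecay Pinf μ ν B (δ₀ / d) ∧ StepRate Pinf μ ν B' (δ₀ / d) (Real.sqrt ((L : ℝ)⁻¹)) ∧
      (∃ K : KernelInputs d Pinf, K.θ = Real.sqrt ((L : ℝ)⁻¹) ∧ K.c₀ = betaPrime510 d (B' / (1 - Real.sqrt ((L : ℝ)⁻¹))) (δ₀ / d) ∧ K.Pinf = limKernelOf Pinf ∧ K.μ = μ ∧ K.ν = ν) ∧
      (∀ k, |B12Beta.secondMoment (Pinf k) μ ν - B12Beta.secondMoment (limKernelOf Pinf) μ ν|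
          ≤ betaPrime510 d (B' / (1 - Real.sqrt ((L : ℝ)⁻¹))) (δ₀ / d) * Real.sqrt ((L : ℝ)⁻¹) ^ k) := by
  have hd1 : 1 ≤ d := le_trans (by norm_num) hd
  have hd2 : 2 ≤ d := le_trans (by norm_num) hd
  have hαβ : 0 ≤ α ∧ 0 ≤ β := (hV 0).nonneg
  have hL1 : (1 : ℝ) < L := by exact_mod_cast (lt_of_lt_of_le one_lt_two hL : 1 < L)
  have hθ0 : 0 ≤ Real.sqrt ((L : ℝ)⁻¹) := Real.sqrt_nonneg _
  have hθ1 : Real.sqrt ((L : ℝ)⁻¹) < 1 := by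
    rw [show (1 : ℝ) = Real.sqrt 1 from Real.sqrt_one.symm]
    exact Real.sqrt_lt_sqrt (inv_nonneg.mpr (Nat.cast_nonneg _)) (inv_lt_one_of_one_lt₀ hL1)
  -- PART 129: (UD) of `c_k(u)⁻¹` and (SR) of `Σ_k(u)`, volume-free on the disc
  obtain ⟨κ₁, B₁, hκ₁, hB₁, hud⟩ := exists_decay_inv_pertCov_QB L a ha hd2 hαβ ha' hκ0 hγ' hδ' hJA hT0 hT₁ hT₂ hT₃
  obtain ⟨κ₂, B₂, hκ₂, hsr⟩ := twoLevelDecayRate_effForm_perturbed L a ha hL hd2 hαβ ha' hκ0 hγ' hδ' hJA hT0 hT₁ hT₂ hT₃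
  -- `B₂ ≥ 0`, read off one diagonal entry
  have hB₂ : 0 ≤ B₂ := by
    have x : idx L (cubic d (evenPeriod 0)) 0 := ((fun _ => 0), ⟨0, hd1⟩)
    have h := hsr (cubic d (evenPeriod 0)) (V 0) (hV 0) u hu a'' 0 x x
    rw [pow_zero, mul_one, distK_self, mul_zero, neg_zero, Real.exp_zero, mul_one] at h
    exact (norm_nonneg _).trans h
  set δ₀ : ℝ := min κ₁ (κ₂ / 2) with hδ₀
  have hδ₀0 : 0 < δ₀ := lt_min hκ₁ (half_pos hκ₂)
  refine ⟨δ₀, B₁ + ‖a''‖ * 1, B₂, hδ₀0, by positivity, hB₂, ?_⟩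
  refine conv_of_decay_of_tendsto L hd1 tendsto_evenPeriod hδ₀0 hθ0 hθ1 (fun t k => ?_) (fun t => ?_) ?_ hne
  · -- (UD) at the common rate
    have h1 : EntryDecay (distK L (cubic d (evenPeriod t)))
        (avgTow (QBlev L (cubic d (evenPeriod t))) ((L : ℝ) ^ d)
          (fun k' => (calDalev L (cubic d (evenPeriod t)) a ha k' + u • Pmodel L (cubic d (evenPeriod t)) (V t) k')⁻¹) k)⁻¹ B₁ δ₀ :=
      entryDecay_of_le_rate (distK_nonneg L (cubic d (evenPeriod t))) (hud (cubic d (evenPeriod t)) (V t) (hV t) u hu k) hB₁.le (min_le_left _ _)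
    have h2 : EntryDecay (distK L (cubic d (evenPeriod t))) (a'' • (1 : Matrix (idx L (cubic d (evenPeriod t)) 0) (idx L (cubic d (evenPeriod t)) 0) ℂ)) (‖a''‖ * 1) δ₀ :=
      entryDecay_smul (entryDecay_one (distK_self L (cubic d (evenPeriod t))) δ₀) a''
    exact entryDecay_sub h1 h2
  · -- (SR) at the common rate
    exact twoLevelDecayRate_of_le_rate (distK_nonneg L (cubic d (evenPeriod t))) (hsr (cubic d (evenPeriod t)) (V t) (hV t) u hu a'') hB₂ hθ0
      ((min_le_right _ _).trans (le_of_eq rfl))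
  · -- the entry limits at the origin pairs
    intro k μ' ν' z
    obtain ⟨s, hs⟩ := tendsto_effFormPert_pair L a ha hd ha' hκ0 hγ' hδ' hJA hT₁ hT₂ hT₃ k hV (hV1 k) hu a'' μ' ν' z 0
    refine ⟨s, hs.congr fun t => ?_⟩
    rw [castT_zero]

end Summit.QuantumFields.BalabanUV.Beta.GAN24.PerturbedEffectiveFormVolumeLimit

end
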